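import Mathlib
import Summits.MatrixMultiplication.MatrixMultiplication.Theorems.SnSubsetDichotomyHyperoctahedralSubsetsSurgeryStep

/-!
# `SnSubsetDichotomy.HyperoctahedralSubsets`, line `spherical-rank-sieve` — the BULK RECURSION over sparse cuts

Crux `stmt-MatrixMultiplication-8305` (`HyperoctahedralSubsets`), co-lead c2 brick `stub_bulkRecursion` (`--supports`).

Co-lead c1 landed the one-step surgery inequality `stub_surgeryStep` (file `…SurgeryStep.lean`): for a set `P`
of even size, if every host on `Fin |P|` carries `G₁` support-disjoint commuting local triples and every host on
`Fin |Pᶜ|` carries `G₂`, then the host `μ` carries `g` of them with `G₁ + G₂ ≤ g + #scars(P)`,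
`scars(P) = {v : ∃ c, ¬(v ∈ P ↔ μ_c v ∈ P)}`.  This file runs the INDUCTION that the one-step inequality was
made for (memo `Cruxes/HyperoctahedralSubsets/LeadC2-ScaleWall.md` §5 (R2), c1 memo `LeadC1-PoorCore.md` §5):

  **`stub_bulkRecursion`.**  Fix `c > 0` and `n₀ ≥ 1`.  Call a cut `P` of a host `μ` on `Fin n` ADMISSIBLE if
  `|P|` is even and `n₀ ≤ |P|`, `n₀ ≤ |Pᶜ|`, and AFFORDABLE if moreover
  `#scars(P) ≤ c (√|P| + √|Pᶜ| − √n)`.  If every host on `n ≥ n₀` points WITHOUT an affordable admissible cut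
  carries at least `c√n` support-disjoint commuting local triples, then EVERY host on `n ≥ n₀` points does.

Proof: strong induction on `n`.  A host with an affordable admissible cut `P` (sides `s, n − s ∈ [n₀, n)`) gets
`⌈c√s⌉₊ + ⌈c√(n−s)⌉₊ − #scars ≥ c√n` triples from the induction hypothesis on both re-matched pieces via
`stub_surgeryStep` (truncating the inductively supplied families to exactly `⌈c√·⌉₊` members); a host without
one is covered by the hypothesis.  The requirement `n₀ ≥ 1` excludes the trivial cuts `P = ∅, univ` (which are
always "affordable" and would make the induction circular).  So the open core `stub_localTriples` /
`stub_poorLocalTriples` may assume, for free, that the host has NO affordable cut — every admissible `P` has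
more than `c(√|P| + √|Pᶜ| − √n) ≥ 0.58 c √(min side)` scars — which is the "√-edge-expander" normalisation of
the 10883 roadmap (D1) and of c1's memo, now as a theorem rather than a remark.  (What the √-slack must NOT be
spent on is mixing: memo §1.)

No new definitions; everything is stated inline in the vocabulary of the registered stubs.
-/

-- the project's summit namespace `Summit.MatrixMultiplication.MatrixMultiplication` repeats a component by design (D-0022)
set_option linter.dupNamespace false

namespace Summit.MatrixMultiplication.MatrixMultiplication.Theorems.HyperoctahedralSubsets

open Finset

/-- Truncation of a support-disjoint family of commuting local triples to its first `G ≤ g` members (along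
`Fin.castLE`): the defining relations are inherited member-wise and disjointness because `Fin.castLE` is
injective. [folklore] -/
theorem tripleFamily_truncate {n g G : ℕ} (μ : Fin 3 → Equiv.Perm (Fin n))
    (a b : Fin g → Equiv.Perm (Fin n)) (hG : G ≤ g)
    (hfam : ∀ j, a j * a j = 1 ∧ b j * b j = 1 ∧ a j * b j = b j * a j ∧ (a j ≠ 1 ∨ b j ≠ 1) ∧
      a j * μ 0 = μ 0 * a j ∧ b j * μ 1 = μ 1 * b j ∧ a j * b j * μ 2 = μ 2 * (a j * b j))
    (hdisj : ∀ j j' : Fin g, j ≠ j' → ∀ x, (a j x ≠ x ∨ b j x ≠ x) → a j' x = x ∧ b j' x = x) :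
    ∃ (a' b' : Fin G → Equiv.Perm (Fin n)),
      (∀ j, a' j * a' j = 1 ∧ b' j * b' j = 1 ∧ a' j * b' j = b' j * a' j ∧ (a' j ≠ 1 ∨ b' j ≠ 1) ∧
        a' j * μ 0 = μ 0 * a' j ∧ b' j * μ 1 = μ 1 * b' j ∧ a' j * b' j * μ 2 = μ 2 * (a' j * b' j)) ∧
      (∀ j j' : Fin G, j ≠ j' → ∀ x, (a' j x ≠ x ∨ b' j x ≠ x) → a' j' x = x ∧ b' j' x = x) := by
  refine ⟨fun j => a (Fin.castLE hG j), fun j => b (Fin.castLE hG j), fun j => hfam _, ?_⟩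
  intro j j' hjj' x hx
  exact hdisj _ _ (fun h => hjj' (Fin.castLE_injective hG h)) x hx

/-- The real-arithmetic step of the recursion: if `G₁ ≥ c√s`, `G₂ ≥ c√t`, `σ ≤ c(√s + √t − √n)` and
`G₁ + G₂ ≤ g + σ`, then `c√n ≤ g`. [folklore] -/
theorem recursion_arith {c : ℝ} {s t n G₁ G₂ g σ : ℕ}
    (h₁ : c * Real.sqrt s ≤ G₁) (h₂ : c * Real.sqrt t ≤ G₂)
    (hσ : (σ : ℝ) ≤ c * (Real.sqrt s + Real.sqrt t - Real.sqrt n))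
    (hg : G₁ + G₂ ≤ g + σ) : c * Real.sqrt n ≤ g := by
  have hg' : (G₁ : ℝ) + G₂ ≤ g + σ := by exact_mod_cast hg
  nlinarith

/-- **Stub `stub_bulkRecursion` — the bulk recursion over sparse cuts** (crux
`SnSubsetDichotomy.HyperoctahedralSubsets`, stmt-MatrixMultiplication-8305, line `spherical-rank-sieve`; c2
brick).  For `c > 0` and `n₀ ≥ 1`: if every triple of fixed-point-free involutions of `Fin n`, `n ≥ n₀`, that
has NO affordable admissible cut — i.e. for every `P` with `|P|` even, `n₀ ≤ |P|`, `n₀ ≤ |Pᶜ|` one has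
`c(√|P| + √|Pᶜ| − √n) < #scars(P)` — admits `g ≥ c√n` support-disjoint commuting local triples, then so does
EVERY triple of fixed-point-free involutions of `Fin n`, `n ≥ n₀`.  Strong induction on `n` through c1's
`stub_surgeryStep`. [folklore] -/
theorem stub_bulkRecursion : ∀ (c : ℝ) (n₀ : ℕ), 0 < c → 1 ≤ n₀ → (∀ n ≥ n₀, ∀ μ : Fin 3 → Equiv.Perm (Fin n), (∀ i, μ i * μ i = 1 ∧ ∀ v, μ i v ≠ v) → (∀ P : Finset (Fin n), Even P.card → n₀ ≤ P.card → n₀ ≤ Pᶜ.card → c * (Real.sqrt (P.card : ℝ) + Real.sqrt (Pᶜ.card : ℝ) - Real.sqrt (n : ℝ)) < ((Finset.univ.filter fun v : Fin n => ∃ i, ¬ (v ∈ P ↔ μ i v ∈ P)).card : ℝ)) → ∃ (g : ℕ) (a b : Fin g → Equiv.Perm (Fin n)), c * Real.sqrt (n : ℝ) ≤ (g : ℝ) ∧ (∀ j, a j * a j = 1 ∧ b j * b j = 1 ∧ a j * b j = b j * a j ∧ (a j ≠ 1 ∨ b j ≠ 1) ∧ a j * μ 0 = μ 0 * a j ∧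 b j * μ 1 = μ 1 * b j ∧ a j * b j * μ 2 = μ 2 * (a j * b j)) ∧ (∀ j j' : Fin g, j ≠ j' → ∀ v, (a j v ≠ v ∨ b j v ≠ v) → a j' v = v ∧ b j' v = v)) → ∀ n ≥ n₀, ∀ μ : Fin 3 → Equiv.Perm (Fin n), (∀ i, μ i * μ i = 1 ∧ ∀ v, μ i v ≠ v) → ∃ (g : ℕ) (a b : Fin g → Equiv.Perm (Fin n)), c * Real.sqrt (n : ℝ) ≤ (g : ℝ) ∧ (∀ j, a j * a j = 1 ∧ b j * b j = 1 ∧ a j * b j = b j * a j ∧ (a j ≠ 1 ∨ b j ≠ 1) ∧ a j * μ 0 = μ 0 * a j ∧ b j * μ 1 = μ 1 * b j ∧ a j * b j * μ 2 = μ 2 * (a j * b j)) ∧ (∀ j j' : Fin g, j ≠ j' → ∀ v, (a j v ≠ v ∨ b j v ≠ v) → a j' v = v ∧ b j' v = v) := by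
  intro c n₀ _hc hn₀ hbase n
  -- strong induction on `n`
  induction n using Nat.strong_induction_on with
  | _ n ih =>
    intro hn μ hμ
    classical
    by_cases hcut : ∃ P : Finset (Fin n), Even P.card ∧ n₀ ≤ P.card ∧ n₀ ≤ Pᶜ.card ∧
        ((Finset.univ.filter fun v : Fin n => ∃ i, ¬ (v ∈ P ↔ μ i v ∈ P)).card : ℝ) ≤
          c * (Real.sqrt (P.card : ℝ) + Real.sqrt (Pᶜ.card : ℝ) - Real.sqrt (n : ℝ))
    · -- an affordable admissible cut: recurse on both re-matched pieces via `stub_surgeryStep`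
      obtain ⟨P, hPeven, hP₀, hPc₀, hσ⟩ := hcut
      have hcardc : Pᶜ.card = n - P.card := by
        rw [Finset.card_compl, Fintype.card_fin]
      have hs_lt : P.card < n := by
        have : n₀ ≤ n - P.card := hcardc ▸ hPc₀
        omega
      have ht_lt : Pᶜ.card < n := by
        rw [hcardc]; omega
      -- induction hypothesis on the two piece sizes, truncated to exactly `⌈c√·⌉₊` members
      set G₁ : ℕ := ⌈c * Real.sqrt (P.card : ℝ)⌉₊ with hG₁
      set G₂ : ℕ := ⌈c * Real.sqrt (Pᶜ.card : ℝ)⌉₊ with hG₂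
      have hIH₁ : ∀ ν : Fin 3 → Equiv.Perm (Fin P.card), (∀ i, ν i * ν i = 1 ∧ ∀ x, ν i x ≠ x) →
          ∃ (a b : Fin G₁ → Equiv.Perm (Fin P.card)),
            (∀ j, a j * a j = 1 ∧ b j * b j = 1 ∧ a j * b j = b j * a j ∧ (a j ≠ 1 ∨ b j ≠ 1) ∧
              a j * ν 0 = ν 0 * a j ∧ b j * ν 1 = ν 1 * b j ∧ a j * b j * ν 2 = ν 2 * (a j * b j)) ∧
            (∀ j j' : Fin G₁, j ≠ j' → ∀ x, (a j x ≠ x ∨ b j x ≠ x) → a j' x = x ∧ b j' x = x) := by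
        intro ν hν
        obtain ⟨g, a, b, hg, hfam, hdisj⟩ := ih P.card hs_lt hP₀ ν hν
        have hle : G₁ ≤ g := Nat.ceil_le.2 hg
        exact tripleFamily_truncate ν a b hle hfam hdisj
      have hIH₂ : ∀ ν : Fin 3 → Equiv.Perm (Fin Pᶜ.card), (∀ i, ν i * ν i = 1 ∧ ∀ x, ν i x ≠ x) →
          ∃ (a b : Fin G₂ → Equiv.Perm (Fin Pᶜ.card)),
            (∀ j, a j * a j = 1 ∧ b j * b j = 1 ∧ a j * b j = b j * a j ∧ (a j ≠ 1 ∨ b j ≠ 1) ∧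
              a j * ν 0 = ν 0 * a j ∧ b j * ν 1 = ν 1 * b j ∧ a j * b j * ν 2 = ν 2 * (a j * b j)) ∧
            (∀ j j' : Fin G₂, j ≠ j' → ∀ x, (a j x ≠ x ∨ b j x ≠ x) → a j' x = x ∧ b j' x = x) := by
        intro ν hν
        obtain ⟨g, a, b, hg, hfam, hdisj⟩ := ih Pᶜ.card ht_lt hPc₀ ν hν
        have hle : G₂ ≤ g := Nat.ceil_le.2 hg
        exact tripleFamily_truncate ν a b hle hfam hdisj
      obtain ⟨g, a, b, hg, hfam, hdisj⟩ := stub_surgeryStep n μ hμ P hPeven G₁ G₂ hIH₁ hIH₂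
      refine ⟨g, a, b, ?_, hfam, hdisj⟩
      exact recursion_arith (Nat.le_ceil _) (Nat.le_ceil _) hσ hg
    · -- no affordable admissible cut: the hypothesis applies
      exact hbase n hn μ hμ fun P hPe hP₀ hPc₀ =>
        lt_of_not_ge fun h => hcut ⟨P, hPe, hP₀, hPc₀, h⟩

end Summit.MatrixMultiplication.MatrixMultiplication.Theorems.HyperoctahedralSubsets
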